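import Summits.ResolutionOfSingularities.ResolutionOfSingularities.Theorems.NonRuledCofinite.Negative.FalseWithoutSingularCentre

/-!
# `RegularModelRuled` (crux `stmt-ResolutionOfSingularities-18077`): the dimension clause
# `2 ≤ dim A_𝔮` is load-bearing

Negative lemma for the crux `RegularModelRuled` of route `ResolutionOfSingularities/RuledResidues`
(Abhyankar's ruledness: a divisorial place `W` of `K/k` dominating a REGULAR local ring `A_𝔮` of
dimension `≥ 2` of an affine model `A` has residue field `κ(W) = L(t)`, `k ⊆ L`, `t` transcendental
over `L`), filed by the standing disprover (cdisprove cycle 1, `--supports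
stmt-ResolutionOfSingularities-18077`; work file `Cruxes/RegularModelRuled/Disproof.lean`). The crux
itself is TRUE (Abhyankar 1956; a complete kernel-checked proof sits in the crux work file
`Cruxes/RegularModelRuled/RuledResiduesRegularModelRuled.lean`); this file shows that its hypothesis
`(2 : WithBot ℕ∞) ≤ ringKrullDim A_𝔮` cannot be dropped:

* `regularModelRuled_false_without_dimTwo` — with the dimension clause deleted (everything else, in
  particular `IsRegularLocalRing A_𝔮`, verbatim) the statement is FALSE at `k = 𝔽₂` (any field works), `K = k(X)`,
  `W = k[X]_{(X)}` (the place `X = 0`), `A = k[X]`: `A_{(X)} = W` is regular of dimension one, and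
  the residue field `κ(W) = k` (`exists_residue_algebraMap_eq`: every residue is the residue of a
  constant) contains no element transcendental over a subfield `L ⊇ k` (`t ∈ L` is a root of
  `X - t ∈ L[X]`).

No definition is declared; the negated statement is the route's telescope verbatim with one
hypothesis deleted; no declaration concludes a route decl positively. The kit of
`Theorems/NonRuledCofinite/Negative/FalseWithoutSingularCentre.lean` (`polyModel`, `place`,
`linPlace`, `place_essFiniteType`) supplies the place and the model.

References: S. S. Abhyankar, *On the valuations centered in a local domain*, Amer. J. Math. 78
(1956), Prop. 3–4; Zariski–Samuel, *Commutative Algebra* II, Ch. VI §14.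
-/

noncomputable section

set_option linter.dupNamespace false

open Polynomial IsDedekindDomain
open Literature.AlgebraicGeometry.Resolution
open Summit.ResolutionOfSingularities.ResolutionOfSingularities.Theorems.NonRuledCofinite.Negative

namespace Summit.ResolutionOfSingularities.ResolutionOfSingularities.Theorems.RegularModelRuled.Negative

variable {k : Type} [Field k]

variable (k) in
/-- The polynomial model `k[X] ⊆ k(X)`, as a SUBRING, is a principal ideal ring (it is the image
of `k[X]`). [folklore] -/
theorem isPrincipalIdealRing_polyModel_toSubring :
    IsPrincipalIdealRing (polyModel k).toSubring := by
  let f : k[X] →+* (polyModel k).toSubring :=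
    (algebraMap k[X] (RatFunc k)).codRestrict (polyModel k).toSubring
      (fun p => algebraMap_mem_polyModel k p)
  refine IsPrincipalIdealRing.of_surjective f fun y => ?_
  obtain ⟨p, hp⟩ := (mem_polyModel_iff k).mp y.2
  exact ⟨p, Subtype.ext hp⟩

/-- Every local ring of the polynomial model is regular: `k[X]` is a Dedekind domain, so its
localisations at primes are fields or discrete valuation rings. [folklore] -/
theorem isRegularLocalRing_localization_polyModel (q : Ideal (polyModel k).toSubring)
    [q.IsPrime] : IsRegularLocalRing (Localization.AtPrime q) :=
  haveI := isPrincipalIdealRing_polyModel_toSubring k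
  IsRegularRing.isRegularLocalRing_localization q

/-- **The residue field of the place `X = c` of `k(X)` is `k`**: every element of the residue
field of `k[X]_{(X - c)}` is the residue of a constant (`n/d ↦ n(c)/d(c)`). [folklore] -/
theorem exists_residue_algebraMap_eq (c : k)
    (z : IsLocalRing.ResidueField (place (linPlace c))) :
    ∃ a : k, IsLocalRing.residue (place (linPlace c))
      ⟨algebraMap k (RatFunc k) a, algebraMap_base_mem_place _ a⟩ = z := by
  obtain ⟨w, hw⟩ :=
    Ideal.Quotient.mk_surjective (I := IsLocalRing.maximalIdeal (place (linPlace c))) z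
  obtain ⟨n, d, hnd⟩ := HeightOneSpectrum.exists_primeCompl_mul_eq_of_integer (linPlace c)
    (w : RatFunc k) ((mem_place_iff_valuation_le_one _ _).mp w.2)
  -- `d ∉ (X - c)`, i.e. `d(c) ≠ 0`
  have hd0 : (d : k[X]).eval c ≠ 0 := by
    intro h0
    apply d.2
    change (d : k[X]) ∈ Ideal.span {X - C c}
    rw [Ideal.mem_span_singleton, dvd_iff_isRoot]
    exact h0
  refine ⟨n.eval c / (d : k[X]).eval c, ?_⟩
  set a : k := n.eval c / (d : k[X]).eval c with ha
  -- `(a - w) · d = C a · d - n` vanishes at `c`, hence lies in the maximal ideal; `d` is a unit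
  have hu : IsUnit (algebraMap k[X] (place (linPlace c)) (d : k[X])) :=
    IsLocalization.map_units (place (linPlace c)) d
  have hmem : algebraMap k[X] (place (linPlace c)) (C a * (d : k[X]) - n) ∈
      IsLocalRing.maximalIdeal (place (linPlace c)) := by
    refine (IsLocalization.AtPrime.to_map_mem_maximal_iff (place (linPlace c))
      (linPlace c).asIdeal _).mpr ?_
    change C a * (d : k[X]) - n ∈ Ideal.span {X - C c}
    rw [Ideal.mem_span_singleton, dvd_iff_isRoot, IsRoot.def, eval_sub, eval_mul, eval_C, ha,
      div_mul_cancel₀ _ hd0, sub_self]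
  have hprod : ((⟨algebraMap k (RatFunc k) a, algebraMap_base_mem_place _ a⟩ :
      place (linPlace c)) - w) * algebraMap k[X] (place (linPlace c)) (d : k[X]) =
        algebraMap k[X] (place (linPlace c)) (C a * (d : k[X]) - n) := by
    apply Subtype.ext
    change (algebraMap k (RatFunc k) a - (w : RatFunc k)) * algebraMap k[X] (RatFunc k) (d : k[X]) =
      algebraMap k[X] (RatFunc k) (C a * (d : k[X]) - n)
    rw [map_sub, map_mul, ← hnd, IsScalarTower.algebraMap_apply k k[X] (RatFunc k) a,
      Polynomial.algebraMap_eq]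
    ring
  have H : (⟨algebraMap k (RatFunc k) a, algebraMap_base_mem_place _ a⟩ : place (linPlace c)) - w ∈
      IsLocalRing.maximalIdeal (place (linPlace c)) := by
    rw [← Ideal.mul_unit_mem_iff_mem _ hu, hprod]
    exact hmem
  rw [← hw]
  exact (Ideal.Quotient.eq (I := IsLocalRing.maximalIdeal (place (linPlace c)))).mpr H

/-- **Any proof of `RegularModelRuled` must use the dimension clause `2 ≤ dim A_𝔮`.** The
statement negated is the crux `RuledResidues.RegularModelRuled` with the hypothesis
`(2 : WithBot ℕ∞) ≤ ringKrullDim (Localization.AtPrime 𝔮)` deleted (all other binders verbatim,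
including regularity of `A_𝔮`). Witness: `k = 𝔽₂` (`ZMod 2`; any field works), `K = k(X)`,
`W = k[X]_{(X)}`, `A = k[X]`: `W` is a divisorial place (`place_essFiniteType`), `A_{(X)} = W` is
regular (of dimension one), and `κ(W) = k` has no element transcendental over any subfield
`L ⊇ k`. [folklore] -/
theorem regularModelRuled_false_without_dimTwo :
    ¬ ∀ (k K : Type) [Field k] [Field K] [Algebra k K] (W : ValuationSubring K)
        (hk : ∀ c : k, algebraMap k K c ∈ W), IsDiscreteValuationRing W →
        (∃ B : Subalgebra k K, B.FG ∧ B.toSubring ≤ W.toSubring ∧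
          ∀ x : K, x ∈ W → ∃ b s : K, b ∈ B ∧ s ∈ B ∧ s ∉ W.nonunits ∧ x * s = b) →
        ∀ A : Subalgebra k K, A.FG → IsFractionRing A K → ∀ h : A.toSubring ≤ W.toSubring,
        IsRegularLocalRing (Localization.AtPrime
          (Ideal.comap (Subring.inclusion h) (IsLocalRing.maximalIdeal W))) →
        ∃ (L : Subfield (IsLocalRing.ResidueField W)) (t : IsLocalRing.ResidueField W),
          (∀ c : k, IsLocalRing.residue W ⟨algebraMap k K c, hk c⟩ ∈ L) ∧
          (∀ f : Polynomial L, f ≠ 0 → Polynomial.eval₂ L.subtype t f ≠ 0) ∧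
          (∀ x : IsLocalRing.ResidueField W, ∃ f g : Polynomial L,
            Polynomial.eval₂ L.subtype t g ≠ 0 ∧
            x * Polynomial.eval₂ L.subtype t g = Polynomial.eval₂ L.subtype t f) := by
  intro h
  obtain ⟨L, t, hL, htr, -⟩ := h (ZMod 2) (RatFunc (ZMod 2)) (place (linPlace (0 : ZMod 2)))
    (algebraMap_base_mem_place _) inferInstance (place_essFiniteType _) (polyModel (ZMod 2))
    (polyModel_fg (ZMod 2)) inferInstance (polyModel_le_place _)
    (isRegularLocalRing_localization_polyModel _)
  obtain ⟨a, ha⟩ := exists_residue_algebraMap_eq (0 : ZMod 2) t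
  have htL : t ∈ L := ha ▸ hL a
  refine htr (Polynomial.X - Polynomial.C ⟨t, htL⟩) (Polynomial.X_sub_C_ne_zero _) ?_
  rw [Polynomial.eval₂_sub, Polynomial.eval₂_X, Polynomial.eval₂_C]
  exact sub_self t

end Summit.ResolutionOfSingularities.ResolutionOfSingularities.Theorems.RegularModelRuled.Negative

end
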